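import Summits.AtomisticToContinuum.HydrodynamicLimit.Theorems.AntiMazurCoboundariesCorrectorPressureDecayKiferTangent
import Literature.Analysis.FunctionSpaces.PointConfigVagueTopology
import Literature.Analysis.FluidPDE.HardSphereTorusMeasure
import Mathlib.MeasureTheory.Measure.Haar.Unique
import Mathlib.Topology.UrysohnsLemma

/-!
# Bias continuity along tangent states, I: torus averaging and the one-body identity at finite `N`

Helper file 1/5 of crux stmt-AtomisticToContinuum-14135 `AntiMazurCoboundaries.CorrectorPressureDecay`, line `FirstLemma` (idea `kifer-compactification`), registered stub `stub_tangentBias : TangentBias`;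
namespace `…Theorems.KiferCompactification` (wave-2 stub-worker B of lead a1, split by the lead). FINITE-`N` SIDE of
the two-scale limit (blow-up by `ε_N⁻¹`, `ε_N = hsDiameter σ N`, then the `φ`-weighted spatial average):

* the TORUS AVERAGING IDENTITY `∫_{𝕋³} k(x) ψ(ε⁻¹ reprSym(q − x)) dx = ε³ ∫_{ℝ³} k(q − proj(ε y)) ψ(y) dy`
  (`ε · supp ψ` inside the injectivity ball of the chart; Haar invariance, `reprSym_# dx = dy|_{(-1/2,1/2]³}`,
  scaling: `integral_mul_comp_reprSym_sub`, `integral_mul_comp_blowUp`), whence the finite-`N` CAMPBELL BOUND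
  `∫_{𝕋³} ψ(ε⁻¹ reprSym(q − x)) dx ≤ ε³ ∫ ψ` for `ψ ≥ 0` (`integral_comp_blowUp_le`);
* the ONE-BODY IDENTITY up to the uniform-continuity error of `φ` (`abs_oneBody_sub_le`) and its limit form
  along any family with `N_k → ∞` (`tendsto_oneBody_sub`, registered as `stub_tendsto_oneBody_sub`):
  `∫φ(x) E_Q[Σᵢ ψ(ε⁻¹reprSym(qᵢ − x)) η(vᵢ)] dx − ε³ (∫ψ) E_Q[Σᵢ φ(qᵢ) η(vᵢ)] → 0`.

References: Olla–Varadhan–Yau 1993 §4 (4.1); Kipnis–Landim 1999 App. 1.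
-/


noncomputable section

open MeasureTheory ProbabilityTheory Set Filter Topology
open scoped ENNReal

namespace Summit.AtomisticToContinuum.HydrodynamicLimit.Theorems.KiferCompactification

open Literature.MathematicalPhysics.KineticTheory (T3 V3 hsDiameter localGibbsLaw blowUpPoint hsDiameter_pos
  succ_mul_hsDiameter_pow_three localGibbsLaw_eq localGibbsMeasure localGibbsMeasure_univ posPartition
  posPartition_nonneg lintegral_localGibbsMeasure lintegral_posWeight_eq_one velMeasure zipConfig zipConfig_apply
  gaussMeasure lintegral_fintype_prod_eq_prod' canonicalPartition_eq_posPartition)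
open Literature.MathematicalPhysics.KineticTheory.PointProcess (laplaceFunctional)
open Literature.Analysis.FluidPDE (HardSphereFlow Config windowSumReal particlesIn particlesIn_eq mem_particlesIn_iff)
open Literature.Analysis.FluidPDE.Torus (reprSym symCube measurable_reprSym map_reprSym_volume proj_reprSym
  closedBall_subset_symCube)
open Literature.Analysis.FunctionSpaces (PointConfig)
open Literature.Analysis.FunctionSpaces.Torus (proj unitCube continuous_proj measurableSet_unitCube mem_unitCube)

/-! ## Torus averaging of blown-up bumps -/

/-- **Torus averaging, chart form.** For measurable `k : 𝕋³ → ℝ` and `Ψ : ℝ³ → ℝ`: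
`∫_{𝕋³} k(x) Ψ(reprSym(q − x)) dx = ∫_{(-1/2,1/2]³} k(q − proj y) Ψ(y) dy` (Haar measure is invariant under
`x ↦ q − x`; `reprSym` pushes Haar measure to Lebesgue measure on the symmetric cube; `proj ∘ reprSym = id`). -/
theorem integral_mul_comp_reprSym_sub {k : T3 → ℝ} (hk : Measurable k) {Ψ : V3 → ℝ} (hΨ : Measurable Ψ)
    (q : T3) :
    ∫ x : T3, k x * Ψ (reprSym (q - x)) = ∫ y in symCube (Fin 3), k (q - proj y) * Ψ y := by
  haveI : (volume : Measure T3).IsNegInvariant := Measure.IsAddHaarMeasure.isNegInvariant_of_regular _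
  have h1 : ∫ x : T3, k x * Ψ (reprSym (q - x)) = ∫ x : T3, k (q - x) * Ψ (reprSym x) := by
    have h := integral_sub_left_eq_self (fun x => k (q - x) * Ψ (reprSym x)) volume q
    simp only [sub_sub_cancel] at h
    exact h
  have h2 : ∫ x : T3, k (q - x) * Ψ (reprSym x) =
      ∫ x : T3, (fun y : V3 => k (q - proj y) * Ψ y) (reprSym x) := by
    simp only [proj_reprSym]
  have hF : Measurable fun y : V3 => k (q - proj y) * Ψ y :=
    (hk.comp (measurable_const.sub continuous_proj.measurable)).mul hΨ
  rw [h1, h2, ← map_reprSym_volume, integral_map measurable_reprSym.aemeasurable hF.aestronglyMeasurable]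

/-- Outside the ball of radius `r ≥` the support radius of `ψ`, the rescaled bump `ψ(ε⁻¹ y)` vanishes off the
symmetric cube once `ε r < 1/2`. -/
theorem comp_inv_smul_eq_zero_of_notMem_symCube {ψ : V3 → ℝ} {ε r : ℝ} (hε : 0 < ε) (hr : ε * r < 1 / 2)
    (hψr : ∀ y, r < ‖y‖ → ψ y = 0) {y : V3} (hy : y ∉ symCube (Fin 3)) : ψ (ε⁻¹ • y) = 0 := by
  refine hψr _ ?_
  by_contra hle
  push Not at hle
  rw [norm_smul, Real.norm_eq_abs, abs_of_pos (inv_pos.2 hε), ← div_eq_inv_mul, div_le_iff₀ hε] at hle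
  refine hy (closedBall_subset_symCube hr ?_)
  rw [Metric.mem_closedBall, dist_zero_right]
  linarith [mul_comm r ε]

/-- **Torus averaging of a blown-up bump.** For measurable `k`, measurable `ψ` vanishing outside the ball of radius
`r`, and a scale `ε > 0` with `ε r < 1/2`:
`∫_{𝕋³} k(x) ψ(ε⁻¹ reprSym(q − x)) dx = ε³ ∫_{ℝ³} k(q − proj(ε y)) ψ(y) dy`. -/
theorem integral_mul_comp_blowUp {k : T3 → ℝ} (hk : Measurable k) {ψ : V3 → ℝ} (hψ : Measurable ψ) {ε r : ℝ}
    (hε : 0 < ε) (hr : ε * r < 1 / 2) (hψr : ∀ y, r < ‖y‖ → ψ y = 0) (q : T3) :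
    ∫ x : T3, k x * ψ (ε⁻¹ • reprSym (q - x)) = ε ^ 3 * ∫ y : V3, k (q - proj (ε • y)) * ψ y := by
  have hΨ : Measurable fun y : V3 => ψ (ε⁻¹ • y) := hψ.comp (measurable_const_smul _)
  rw [integral_mul_comp_reprSym_sub hk hΨ q]
  have h1 : ∫ y in symCube (Fin 3), k (q - proj y) * ψ (ε⁻¹ • y) = ∫ y : V3, k (q - proj y) * ψ (ε⁻¹ • y) := by
    refine setIntegral_eq_integral_of_forall_compl_eq_zero fun y hy => ?_
    rw [comp_inv_smul_eq_zero_of_notMem_symCube hε hr hψr hy, mul_zero]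
  have h2 : (fun y : V3 => k (q - proj y) * ψ (ε⁻¹ • y)) =
      fun y : V3 => (fun y' : V3 => k (q - proj (ε • y')) * ψ y') (ε⁻¹ • y) := by
    funext y
    simp only [smul_smul, mul_inv_cancel₀ hε.ne', one_smul]
  rw [h1, h2, Measure.integral_comp_inv_smul_of_nonneg volume (fun y' : V3 => k (q - proj (ε • y')) * ψ y') hε.le,
    finrank_euclideanSpace_fin, smul_eq_mul]

/-- **Campbell bound at finite `N`.** For a continuous compactly supported `ψ ≥ 0` and `ε > 0`:
`∫_{𝕋³} ψ(ε⁻¹ reprSym(q − x)) dx ≤ ε³ ∫_{ℝ³} ψ` (no smallness of `ε` needed: the chart integral over the symmetric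
cube is at most the integral over all of `ℝ³`). -/
theorem integral_comp_blowUp_le {ψ : V3 → ℝ} (hψ : Continuous ψ) (hcs : HasCompactSupport ψ)
    (h0 : ∀ y, 0 ≤ ψ y) {ε : ℝ} (hε : 0 < ε) (q : T3) :
    ∫ x : T3, ψ (ε⁻¹ • reprSym (q - x)) ≤ ε ^ 3 * ∫ y : V3, ψ y := by
  have hΨ : Measurable fun y : V3 => ψ (ε⁻¹ • y) := hψ.measurable.comp (measurable_const_smul _)
  have h1 : ∫ x : T3, ψ (ε⁻¹ • reprSym (q - x)) = ∫ x : T3, (fun _ => (1 : ℝ)) x * ψ (ε⁻¹ • reprSym (q - x)) := by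
    simp only [one_mul]
  rw [h1, integral_mul_comp_reprSym_sub measurable_const hΨ q]
  simp only [one_mul]
  have hint : Integrable (fun y : V3 => ψ (ε⁻¹ • y)) :=
    (hψ.integrable_of_hasCompactSupport hcs).comp_smul (inv_ne_zero hε.ne')
  calc ∫ y in symCube (Fin 3), ψ (ε⁻¹ • y) ≤ ∫ y : V3, ψ (ε⁻¹ • y) :=
        setIntegral_le_integral hint (Eventually.of_forall fun y => h0 _)
    _ = ε ^ 3 * ∫ y : V3, ψ y := by
        rw [Measure.integral_comp_inv_smul_of_nonneg volume ψ hε.le, finrank_euclideanSpace_fin, smul_eq_mul]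

/-- The sup-norm of a projected vector on `𝕋³` is at most its Euclidean norm: `‖proj v‖ ≤ ‖v‖`. -/
theorem norm_proj_le (v : V3) : ‖proj v‖ ≤ ‖v‖ := by
  rw [pi_norm_le_iff_of_nonneg (norm_nonneg v)]
  intro i
  rw [Literature.Analysis.FunctionSpaces.Torus.proj_apply]
  calc ‖((v i : ℝ) : UnitAddCircle)‖ ≤ ‖v i‖ := QuotientAddGroup.norm_mk_le_norm
    _ ≤ ‖v‖ := by simpa using PiLp.norm_apply_le v i

/-- The hard-sphere diameter tends to `0` along sizes `N k ≥ k`. -/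
theorem tendsto_hsDiameter {σ : ℝ} {N : ℕ → ℕ} (hN : ∀ k, k ≤ N k) :
    Tendsto (fun k => hsDiameter σ (N k)) atTop (𝓝 0) := by
  have h1 : Tendsto (fun k => ((N k + 1 : ℕ) : ℝ)) atTop atTop :=
    tendsto_natCast_atTop_atTop.comp (tendsto_atTop_mono (fun k => Nat.le_succ_of_le (hN k)) tendsto_id)
  have h2 : Tendsto (fun k => ((N k + 1 : ℕ) : ℝ) ^ (-(1 / 3 : ℝ))) atTop (𝓝 0) :=
    (tendsto_rpow_neg_atTop (by norm_num)).comp h1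
  have h3 := h2.const_mul σ
  rw [mul_zero] at h3
  exact h3

/-! ## The one-body identity at finite `N` -/

/-- Bounded measurable functions on a finite measure space are integrable (real-valued, `|f| ≤ C`). -/
private theorem integrable_of_abs_le {α : Type*} [MeasurableSpace α] {μ : Measure α} [IsFiniteMeasure μ]
    {f : α → ℝ} (hfm : Measurable f) {C : ℝ} (hfC : ∀ x, |f x| ≤ C) : Integrable f μ :=
  Integrable.of_bound hfm.aestronglyMeasurable C (ae_of_all _ fun x => by rw [Real.norm_eq_abs]; exact hfC x)

/-- Coordinates of labelled configurations are measurable: the position of particle `i`. -/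
private theorem measurable_pos {n : ℕ} (i : Fin n) : Measurable fun z : Config n (Fin 3) T3 => (z i).1 :=
  (measurable_pi_apply i).fst

/-- Coordinates of labelled configurations are measurable: the velocity of particle `i`. -/
private theorem measurable_vel {n : ℕ} (i : Fin n) : Measurable fun z : Config n (Fin 3) T3 => (z i).2 :=
  (measurable_pi_apply i).snd

/-- **One-body identity at fixed `N`, quantitative.** For a probability law `Q` on `n`-particle torus phase space,
`|φ| ≤ 1` continuous, a continuous bump `ψ` vanishing outside the ball of radius `r`, a continuous `η` with `|η| ≤ C`,
a scale `e > 0` with `e r < 1/2`, and a modulus `δ'` with `|φ(q − proj(e y)) − φ(q)| ≤ δ'` for `‖y‖ ≤ r`: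
`|∫φ(x) E_Q[Σᵢ ψ(e⁻¹reprSym(qᵢ − x)) η(vᵢ)] dx − e³ (∫ψ) E_Q[Σᵢ φ(qᵢ) η(vᵢ)]| ≤ n C e³ δ' ∫|ψ|`
(Fubini, the torus averaging identity particle by particle, and the modulus of continuity of `φ`). -/
theorem abs_oneBody_sub_le {n : ℕ} (Q : Measure (Config n (Fin 3) T3)) [IsProbabilityMeasure Q]
    {φ : T3 → ℝ} (hφ : Continuous φ) (hφ1 : ∀ x, |φ x| ≤ 1) {ψ : V3 → ℝ} (hψ : Continuous ψ)
    (hψcs : HasCompactSupport ψ) {η : V3 → ℝ} (hη : Continuous η) {C : ℝ} (hηC : ∀ v, |η v| ≤ C)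
    {e r δ' : ℝ} (he : 0 < e) (hr : e * r < 1 / 2) (hψr : ∀ y, r < ‖y‖ → ψ y = 0)
    (hmod : ∀ q : T3, ∀ y : V3, ‖y‖ ≤ r → |φ (q - proj (e • y)) - φ q| ≤ δ') :
    |(∫ x : T3, φ x * ∫ z, (∑ i, ψ (e⁻¹ • reprSym ((z i).1 - x)) * η (z i).2) ∂Q) -
      e ^ 3 * (∫ y, ψ y) * ∫ z, (∑ i, φ (z i).1 * η (z i).2) ∂Q| ≤ n * C * e ^ 3 * (δ' * ∫ y, |ψ y|) := by
  obtain ⟨B, hB⟩ := hψ.bounded_above_of_compact_support hψcs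
  have hC0 : 0 ≤ C := (abs_nonneg _).trans (hηC 0)
  have hB0 : 0 ≤ B := (norm_nonneg _).trans (hB 0)
  -- the torus average of the bump seen from `q`
  set I : T3 → ℝ := fun q => ∫ x : T3, φ x * ψ (e⁻¹ • reprSym (q - x)) with hI
  have hIeq : ∀ q, I q = e ^ 3 * ∫ y : V3, φ (q - proj (e • y)) * ψ y := fun q =>
    integral_mul_comp_blowUp hφ.measurable hψ.measurable he hr hψr q
  -- (c) the modulus-of-continuity estimate, particle by particle
  have hIest : ∀ q, |I q - e ^ 3 * φ q * ∫ y, ψ y| ≤ e ^ 3 * (δ' * ∫ y, |ψ y|) := by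
    intro q
    have hint1 : Integrable (fun y : V3 => φ (q - proj (e • y)) * ψ y) :=
      ((hφ.comp (continuous_const.sub (continuous_proj.comp (continuous_const_smul e)))).mul hψ)
        |>.integrable_of_hasCompactSupport hψcs.mul_left
    have hint2 : Integrable (fun y : V3 => φ q * ψ y) :=
      (hψ.integrable_of_hasCompactSupport hψcs).const_mul _
    have hsub : (∫ y : V3, φ (q - proj (e • y)) * ψ y) - φ q * ∫ y, ψ y =
        ∫ y : V3, (φ (q - proj (e • y)) - φ q) * ψ y := by
      rw [← integral_const_mul, ← integral_sub hint1 hint2]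
      refine integral_congr_ae (ae_of_all _ fun y => ?_)
      ring
    have hpt : ∀ y : V3, ‖(φ (q - proj (e • y)) - φ q) * ψ y‖ ≤ δ' * |ψ y| := by
      intro y
      rw [Real.norm_eq_abs, abs_mul]
      by_cases hy : r < ‖y‖
      · rw [hψr y hy, abs_zero, mul_zero, mul_zero]
      · exact mul_le_mul_of_nonneg_right (hmod q y (not_lt.1 hy)) (abs_nonneg _)
    have hle : |(∫ y : V3, φ (q - proj (e • y)) * ψ y) - φ q * ∫ y, ψ y| ≤ δ' * ∫ y, |ψ y| := by
      rw [hsub, ← Real.norm_eq_abs, ← integral_const_mul]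
      exact norm_integral_le_of_norm_le (((hψ.integrable_of_hasCompactSupport hψcs).abs).const_mul _)
        (ae_of_all _ hpt)
    rw [hIeq q, show e ^ 3 * (∫ y : V3, φ (q - proj (e • y)) * ψ y) - e ^ 3 * φ q * ∫ y, ψ y =
      e ^ 3 * ((∫ y : V3, φ (q - proj (e • y)) * ψ y) - φ q * ∫ y, ψ y) by ring, abs_mul,
      abs_of_pos (pow_pos he 3)]
    exact mul_le_mul_of_nonneg_left hle (pow_pos he 3).le
  -- (a) Fubini: the joint integrand
  set W : T3 → Config n (Fin 3) T3 → ℝ := fun x z =>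
    ∑ i, η (z i).2 * (φ x * ψ (e⁻¹ • reprSym ((z i).1 - x))) with hW
  have hWm : Measurable (Function.uncurry W) := by
    refine Finset.measurable_sum _ fun i _ => ?_
    have h1 : Measurable fun p : T3 × Config n (Fin 3) T3 => (p.2 i).1 := (measurable_pos i).comp measurable_snd
    have h2 : Measurable fun p : T3 × Config n (Fin 3) T3 => (p.2 i).2 := (measurable_vel i).comp measurable_snd
    have h3 : Measurable fun p : T3 × Config n (Fin 3) T3 => e⁻¹ • reprSym ((p.2 i).1 - p.1) :=
      (measurable_const_smul e⁻¹).comp (measurable_reprSym.comp (h1.sub measurable_fst))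
    exact (hη.measurable.comp h2).mul ((hφ.measurable.comp measurable_fst).mul (hψ.measurable.comp h3))
  -- termwise bound
  have hterm : ∀ (x : T3) (z : Config n (Fin 3) T3) (i : Fin n),
      |η (z i).2 * (φ x * ψ (e⁻¹ • reprSym ((z i).1 - x)))| ≤ C * B := by
    intro x z i
    rw [abs_mul, abs_mul]
    refine mul_le_mul (hηC _) ?_ (by positivity) hC0
    calc |φ x| * |ψ (e⁻¹ • reprSym ((z i).1 - x))| ≤ 1 * B :=
          mul_le_mul (hφ1 x) (by rw [← Real.norm_eq_abs]; exact hB _) (abs_nonneg _) zero_le_one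
      _ = B := one_mul B
  have hWb : ∀ p : T3 × Config n (Fin 3) T3, ‖Function.uncurry W p‖ ≤ n * (C * B) := by
    rintro ⟨x, z⟩
    rw [Function.uncurry_apply_pair, Real.norm_eq_abs, hW]
    dsimp only
    calc |∑ i, η (z i).2 * (φ x * ψ (e⁻¹ • reprSym ((z i).1 - x)))|
        ≤ ∑ i, |η (z i).2 * (φ x * ψ (e⁻¹ • reprSym ((z i).1 - x)))| := Finset.abs_sum_le_sum_abs _ _
      _ ≤ ∑ _i : Fin n, C * B := Finset.sum_le_sum fun i _ => hterm x z i
      _ = n * (C * B) := by simp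
  have hWi : Integrable (Function.uncurry W) ((volume : Measure T3).prod Q) :=
    Integrable.of_bound hWm.aestronglyMeasurable _ (ae_of_all _ hWb)
  -- the left-hand side as an iterated integral of `W`
  have hlhs : (∫ x : T3, φ x * ∫ z, (∑ i, ψ (e⁻¹ • reprSym ((z i).1 - x)) * η (z i).2) ∂Q) =
      ∫ x : T3, ∫ z, W x z ∂Q := by
    refine integral_congr_ae (ae_of_all _ fun x => ?_)
    dsimp only
    rw [← integral_const_mul]
    refine integral_congr_ae (ae_of_all _ fun z => ?_)
    dsimp only
    rw [hW, Finset.mul_sum]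
    exact Finset.sum_congr rfl fun i _ => by ring
  -- the inner `x`-integral, particle by particle
  have hinner : ∀ z : Config n (Fin 3) T3, ∫ x : T3, W x z = ∑ i, η (z i).2 * I (z i).1 := by
    intro z
    simp only [hW]
    rw [integral_finsetSum _ fun i _ => ?_]
    · exact Finset.sum_congr rfl fun i _ => integral_const_mul _ _
    · have h3 : Measurable fun x : T3 => e⁻¹ • reprSym ((z i).1 - x) :=
        (measurable_const_smul e⁻¹).comp (measurable_reprSym.comp (measurable_const.sub measurable_id))
      have h4 : Measurable fun x : T3 => φ x * ψ (e⁻¹ • reprSym ((z i).1 - x)) :=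
        hφ.measurable.mul (hψ.measurable.comp h3)
      refine (integrable_of_abs_le h4 (C := B) fun x => ?_).const_mul _
      rw [abs_mul]
      calc |φ x| * |ψ (e⁻¹ • reprSym ((z i).1 - x))| ≤ 1 * B :=
            mul_le_mul (hφ1 x) (by rw [← Real.norm_eq_abs]; exact hB _) (abs_nonneg _) zero_le_one
        _ = B := one_mul B
  have hswap : (∫ x : T3, ∫ z, W x z ∂Q) = ∫ z, (∑ i, η (z i).2 * I (z i).1) ∂Q := by
    rw [integral_integral_swap hWi]
    exact integral_congr_ae (ae_of_all _ hinner)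
  -- integrability of the swapped integrand (Fubini) and of the comparison term
  have hint3 : Integrable (fun z => ∑ i, η (z i).2 * I (z i).1) Q := by
    have h := hWi.integral_prod_right
    refine h.congr (ae_of_all _ fun z => ?_)
    exact hinner z
  have hint4 : Integrable (fun z : Config n (Fin 3) T3 => ∑ i, η (z i).2 * (e ^ 3 * φ (z i).1 * ∫ y, ψ y)) Q := by
    refine integrable_of_abs_le (Finset.measurable_sum _ fun i _ =>
      (hη.measurable.comp (measurable_vel i)).mul
        (((hφ.measurable.comp (measurable_pos i)).const_mul _).mul_const _))
      (C := n * (C * (e ^ 3 * 1 * |∫ y, ψ y|))) fun z => ?_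
    have hterm' : ∀ i : Fin n, |η (z i).2 * (e ^ 3 * φ (z i).1 * ∫ y, ψ y)| ≤ C * (e ^ 3 * 1 * |∫ y, ψ y|) := by
      intro i
      rw [abs_mul, abs_mul, abs_mul, abs_of_pos (pow_pos he 3)]
      gcongr
      · exact hηC _
      · exact hφ1 _
    calc |∑ i, η (z i).2 * (e ^ 3 * φ (z i).1 * ∫ y, ψ y)| ≤ ∑ i, |η (z i).2 * (e ^ 3 * φ (z i).1 * ∫ y, ψ y)| :=
          Finset.abs_sum_le_sum_abs _ _
      _ ≤ ∑ _i : Fin n, C * (e ^ 3 * 1 * |∫ y, ψ y|) := Finset.sum_le_sum fun i _ => hterm' i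
      _ = n * (C * (e ^ 3 * 1 * |∫ y, ψ y|)) := by simp
  -- the right-hand side rewritten as one integral
  have hrhs : e ^ 3 * (∫ y, ψ y) * ∫ z, (∑ i, φ (z i).1 * η (z i).2) ∂Q =
      ∫ z, (∑ i, η (z i).2 * (e ^ 3 * φ (z i).1 * ∫ y, ψ y)) ∂Q := by
    rw [← integral_const_mul]
    refine integral_congr_ae (ae_of_all _ fun z => ?_)
    dsimp only
    rw [Finset.mul_sum]
    exact Finset.sum_congr rfl fun i _ => by ring
  -- (d) combine
  rw [hlhs, hswap, hrhs, ← integral_sub hint3 hint4]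
  have hpt : ∀ z : Config n (Fin 3) T3,
      ‖(∑ i, η (z i).2 * I (z i).1) - ∑ i, η (z i).2 * (e ^ 3 * φ (z i).1 * ∫ y, ψ y)‖ ≤
        n * C * e ^ 3 * (δ' * ∫ y, |ψ y|) := by
    intro z
    rw [Real.norm_eq_abs, ← Finset.sum_sub_distrib]
    refine (Finset.abs_sum_le_sum_abs _ _).trans ?_
    have hterm : ∀ i, |η (z i).2 * I (z i).1 - η (z i).2 * (e ^ 3 * φ (z i).1 * ∫ y, ψ y)| ≤
        C * (e ^ 3 * (δ' * ∫ y, |ψ y|)) := by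
      intro i
      rw [← mul_sub, abs_mul]
      exact mul_le_mul (hηC _) (hIest (z i).1) (abs_nonneg _) hC0
    refine (Finset.sum_le_sum fun i _ => hterm i).trans_eq ?_
    simp only [Finset.sum_const, Finset.card_univ, Fintype.card_fin, nsmul_eq_mul]
    ring
  have h := norm_integral_le_of_norm_le_const (μ := Q) (ae_of_all _ hpt)
  rwa [probReal_univ, mul_one, Real.norm_eq_abs] at h

/-- **One-body identity at finite `N`, up to the uniform-continuity error of `φ`** (the finite-`N` half of bias
continuity): along sizes `N k ≥ k` (so `ε_k = hsDiameter σ (N k) → 0`) and probability laws `Q k`, for continuous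
`|φ| ≤ 1`, a continuous compactly supported bump `ψ` and a bounded continuous `η`,
`∫φ(x) E_{Q k}[Σᵢ ψ((blowUpPoint ε_k x zᵢ).1) η(vᵢ)] dx − ε_k³ (∫ψ) E_{Q k}[Σᵢ φ(qᵢ) η(vᵢ)] → 0`
(`(N k + 1) ε_k³ = σ³` and uniform continuity of `φ` on the compact torus). -/
theorem tendsto_oneBody_sub {σ : ℝ} (hσ : 0 < σ) {φ : T3 → ℝ} (hφ : Continuous φ) (hφ1 : ∀ x, |φ x| ≤ 1)
    {N : ℕ → ℕ} (hN : ∀ k, k ≤ N k) (Q : ∀ k, Measure (Config (N k + 1) (Fin 3) T3))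
    (hQ : ∀ k, IsProbabilityMeasure (Q k)) {ψ : V3 → ℝ} (hψ : Continuous ψ) (hψcs : HasCompactSupport ψ)
    {η : V3 → ℝ} (hη : Continuous η) {C : ℝ} (hηC : ∀ v, |η v| ≤ C) :
    Tendsto (fun k => (∫ x : T3, φ x *
        ∫ z, (∑ i, ψ (blowUpPoint (hsDiameter σ (N k)) x (z i)).1 * η (z i).2) ∂Q k) -
      hsDiameter σ (N k) ^ 3 * (∫ y, ψ y) * ∫ z, (∑ i, φ (z i).1 * η (z i).2) ∂Q k) atTop (𝓝 0) := by
  -- support radius of the bump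
  obtain ⟨r₀, hr₀⟩ := hψcs.isCompact.isBounded.subset_closedBall (0 : V3)
  set r : ℝ := max r₀ 0 with hrdef
  have hr0 : 0 ≤ r := le_max_right _ _
  have hψr : ∀ y, r < ‖y‖ → ψ y = 0 := fun y hy =>
    image_eq_zero_of_notMem_tsupport fun h => by
      have h' := hr₀ h
      rw [Metric.mem_closedBall, dist_zero_right] at h'
      exact absurd (h'.trans (le_max_left _ _)) (not_le.2 hy)
  have hC0 : 0 ≤ C := (abs_nonneg _).trans (hηC 0)
  set M : ℝ := σ ^ 3 * C * ∫ y, |ψ y| with hM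
  have hM0 : 0 ≤ M := by positivity
  rw [Metric.tendsto_atTop]
  intro δ hδ
  -- modulus of continuity of `φ`
  obtain ⟨τ, hτ, hφτ⟩ := Metric.uniformContinuous_iff.1 (CompactSpace.uniformContinuous_of_continuous hφ)
    (δ / (M + 1)) (by positivity)
  -- scales eventually below the two thresholds
  obtain ⟨K, hK⟩ := (Metric.tendsto_atTop.1 (tendsto_hsDiameter (σ := σ) hN)) (min (1 / 2) τ / (r + 1))
    (by positivity)
  refine ⟨K, fun k hk => ?_⟩
  haveI := hQ k
  set e : ℝ := hsDiameter σ (N k) with hedef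
  have he : 0 < e := hsDiameter_pos hσ _
  have heK : e < min (1 / 2) τ / (r + 1) := by
    have h := hK k hk
    rwa [dist_zero_right, Real.norm_eq_abs, abs_of_pos he] at h
  have her : e * r < min (1 / 2) τ := by
    have h1 : e * r ≤ e * (r + 1) := by nlinarith
    have h2 : e * (r + 1) < min (1 / 2) τ := by rwa [lt_div_iff₀ (by positivity)] at heK
    exact h1.trans_lt h2
  have hhalf : e * r < 1 / 2 := her.trans_le (min_le_left _ _)
  have htau : e * r < τ := her.trans_le (min_le_right _ _)
  have hmod : ∀ q : T3, ∀ y : V3, ‖y‖ ≤ r → |φ (q - proj (e • y)) - φ q| ≤ δ / (M + 1) := by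
    intro q y hy
    have hd : dist (q - proj (e • y)) q < τ := by
      rw [dist_eq_norm, sub_sub_cancel_left, norm_neg]
      calc ‖proj (e • y)‖ ≤ ‖e • y‖ := norm_proj_le _
        _ = e * ‖y‖ := by rw [norm_smul, Real.norm_eq_abs, abs_of_pos he]
        _ ≤ e * r := by gcongr
        _ < τ := htau
    have h := hφτ hd
    rw [Real.dist_eq] at h
    exact h.le
  have hmain := abs_oneBody_sub_le (Q k) hφ hφ1 hψ hψcs hη hηC he hhalf hψr hmod
  rw [dist_zero_right, Real.norm_eq_abs]
  refine lt_of_le_of_lt (le_of_eq_of_le ?_ hmain) ?_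
  · simp only [blowUpPoint, hedef]
  · have hNe : ((N k + 1 : ℕ) : ℝ) * C * e ^ 3 * (δ / (M + 1) * ∫ y, |ψ y|) = M * (δ / (M + 1)) := by
      have h3 : ((N k + 1 : ℕ) : ℝ) * e ^ 3 = σ ^ 3 := succ_mul_hsDiameter_pow_three σ (N k)
      rw [hM]
      calc ((N k + 1 : ℕ) : ℝ) * C * e ^ 3 * (δ / (M + 1) * ∫ y, |ψ y|)
          = (((N k + 1 : ℕ) : ℝ) * e ^ 3) * C * (∫ y, |ψ y|) * (δ / (M + 1)) := by ring
        _ = σ ^ 3 * C * (∫ y, |ψ y|) * (δ / (M + 1)) := by rw [h3]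
    push_cast at hNe ⊢
    rw [hNe]
    calc M * (δ / (M + 1)) < (M + 1) * (δ / (M + 1)) := by gcongr; linarith
      _ = δ := by field_simp

/-- Registered stub `stub_tendsto_oneBody_sub` (line `FirstLemma`, helper of `stub_tangentBias`): the one-body
identity in limit form (= `tendsto_oneBody_sub`). -/
theorem stub_tendsto_oneBody_sub {σ : ℝ} (hσ : 0 < σ) {φ : T3 → ℝ} (hφ : Continuous φ) (hφ1 : ∀ x, |φ x| ≤ 1)
    {N : ℕ → ℕ} (hN : ∀ k, k ≤ N k) (Q : ∀ k, Measure (Config (N k + 1) (Fin 3) T3))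
    (hQ : ∀ k, IsProbabilityMeasure (Q k)) {ψ : V3 → ℝ} (hψ : Continuous ψ) (hψcs : HasCompactSupport ψ)
    {η : V3 → ℝ} (hη : Continuous η) {C : ℝ} (hηC : ∀ v, |η v| ≤ C) :
    Tendsto (fun k => (∫ x : T3, φ x *
        ∫ z, (∑ i, ψ (blowUpPoint (hsDiameter σ (N k)) x (z i)).1 * η (z i).2) ∂Q k) -
      hsDiameter σ (N k) ^ 3 * (∫ y, ψ y) * ∫ z, (∑ i, φ (z i).1 * η (z i).2) ∂Q k) atTop (𝓝 0) :=
  tendsto_oneBody_sub hσ hφ hφ1 hN Q hQ hψ hψcs hη hηC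

end Summit.AtomisticToContinuum.HydrodynamicLimit.Theorems.KiferCompactification
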